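import Literature.AlgebraicGeometry.ShimuraVarieties.UnitaryBallClassLiftClosed
import Literature.AlgebraicGeometry.ShimuraVarieties.UnitaryBallFundamentalGroup
import Literature.AlgebraicTopology.SingularHomology.FundamentalGroupQuotientRank
import HarnessLib

/-!
# The period group of the holomorphic `1`-forms of a compact ball quotient: definition and rank

Layer `Literature/AlgebraicGeometry/ShimuraVarieties`, sequel of `UnitaryBallClassLiftClosed` (closedness
of lifted holomorphic `1`-forms, their primitives and periods on the ball), `UnitaryBallFundamentalGroup`
(`π₁(X(ℂ)) ≅ Γᵐᵒᵖ`, `Γ` finitely generated) and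
`AlgebraicTopology/SingularHomology/FundamentalGroupQuotientRank` (a free finitely generated abelian
quotient of `π₁` has rank `≤ b₁`).  DEFINITIONS WITH BODIES + THEOREMS; no named fact.

Let `X` be a compact ball quotient surface (`D : UnitaryBallUniformisationDatum 2 X`, `X(ℂ) = Γ \ 𝔹²`),
`A` a Hodge model of `X`, `𝔣` a Sylvester frame and `b : Basis ι ℂ Ω¹(X^an)` a basis of the holomorphic
`1`-forms `holFormsInCharts A.model A.carrier 1`.  Following Griffiths–Harris, Ch. 2 §6 (the Albanese
variety `Alb(X) = H⁰(X, Ω¹)^* / H₁(X, ℤ)`, the lattice being the group of period vectors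
`(∫_γ ω₁, …, ∫_γ ω_q)`), we define

* `D.periodVec A 𝔣 b γ : ι → ℂ` — the **period vector** of `γ ∈ Γ`: its `i`-th coordinate is the period
  `BallForms.period (ψ^* bᵢ) (ρ_𝔣 γ)` of the lifted form `ψ^* bᵢ = D.formPullback₁ A 𝔣 (b i)` on the
  ball (`UnitaryBallFormPrimitives`: `P(γ z) − P(z)` for the holomorphic primitive `P` of `ψ^* bᵢ`);
* `D.periodHom A 𝔣 b : Additive Γ →+ (ι → ℂ)` — `γ ↦ periodVec γ` is a homomorphism
  (`periodVec_mul`, from `BallForms.period_mul`);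
* `D.periodLattice A 𝔣 b : Submodule ℤ (ι → ℂ)` — the **period group** `Λ`, the image of `Γ`.

and prove

* `primitive_formPullback₁_smul_eq_add_period`, `period_formPullback₁_mul` — the transformation law
  and additivity of periods for every `α ∈ Ω¹(X^an)` (the hypotheses of `UnitaryBallFormPrimitives` are
  met: `ψ^* α` is holomorphic, `Γ`-automorphic of cotangent type and CLOSED,
  `isClosedForm_formPullback₁_of_mem`);
* `mem_periodLattice_iff` — `Λ = {periodVec γ}`;
* `finite_periodLattice` — **`Λ` is finitely generated** (`Γ` is, `fg_Γ`);
* `free_periodLattice` — `Λ` is a free `ℤ`-module (torsion free);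
* **`finrank_periodLattice_le` — `rank_ℤ Λ ≤ b₁(X) = dim_ℚ H¹(X(ℂ); ℚ)`**: `Λ` is an additive image of
  `π₁(X(ℂ)) ≅ Γ` (`nonempty_fundamentalGroup_complexPoints_mulEquiv`), and free finitely generated abelian
  quotients of `π₁` have rank at most `b₁` (`finrank_le_finrank_singularCohomology_one_of_surjective`).

The complementary facts — `Λ` spans `ℂ^ι` over `ℝ` (maximum principle) and hence is a full lattice of
rank `2 h^{1,0} = b₁` — are the sequel `UnitaryBallPeriodLatticeSpan`.

## References

* [GriffithsHarris1978] P. Griffiths, J. Harris, *Principles of Algebraic Geometry* (1978), Ch. 2 §6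
  (Albanese variety; the periods form a lattice).
* [VoisinHodgeI2002] C. Voisin, *Hodge Theory and Complex Algebraic Geometry I* (2002), §12.1.2
  (Albanese), §7.1.1.
* [Borel1997] A. Borel, *Automorphic forms on `SL₂(ℝ)`* (1997), §5.14.
* [HatcherAT2002] A. Hatcher, *Algebraic Topology* (2002), Thm. 2A.1, §3.1.
-/

noncomputable section

open Matrix MulAction Function Set Filter Module
open scoped Manifold Topology TensorProduct
open Literature.Geometry.ComplexHyperbolic
open Literature.Geometry.ComplexHyperbolic.BallModel (U21 Ball Jac x₀ nsq actVec)
open Literature.Geometry.Kaehler (MForm IsHolomorphicInCharts holFormsInCharts isOfType_of_mem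
  isHolomorphicInCharts_of_mem isSmoothForm_of_mem)
open Literature.NumberTheory.Transcendental
open Literature.NumberTheory.Automorphic.AutomorphyFactor
open Literature.AlgebraicGeometry.HodgeTheory
open Literature.AlgebraicGeometry.Motives (bettiCohomology)
open Literature.AlgebraicTopology.SingularHomology

namespace Literature.AlgebraicGeometry.ShimuraVarieties

namespace UnitaryBallUniformisationDatum

variable {X : Motives.SchemeOver ℂ} (D : UnitaryBallUniformisationDatum 2 X) (A : HodgeModel 2 X)
  (𝔣 : D.SylvesterFrame)

/-! ### Periods of the holomorphic `1`-forms of `X^an` -/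

section Forms

variable (α : holFormsInCharts A.model A.carrier 1)

/-- The lift `ψ^* α` of a holomorphic `1`-form is a holomorphic function on the ball.
[cite: Borel1997, §5.14] -/
theorem formPullback₁_coe_mem_holomorphic :
    D.formPullback₁ A 𝔣 (α : MForm 𝓘(ℝ, A.model) A.carrier ℂ 1) ∈ BallForms.holomorphic (Fin 2 → ℂ) :=
  formPullback₁_mem_holomorphic (D := D) (A := A) (𝔣 := 𝔣) (isHolomorphicInCharts_of_mem α)

/-- The lift `ψ^* α` of a holomorphic `1`-form is `Γ`-automorphic of cotangent type (all of `Γ`).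
[cite: Borel1997, §5.14] -/
theorem formPullback₁_coe_mem_factorForms :
    D.formPullback₁ A 𝔣 (α : MForm 𝓘(ℝ, A.model) A.carrier ℂ 1) ∈
      factorForms ((⊤ : Subgroup D.Γ).map (D.ballRep 𝔣)) BallForms.cotangentCocycle :=
  formPullback₁_mem_factorForms_of_isOfType (D := D) (A := A) (𝔣 := 𝔣) (isOfType_of_mem α) ⊤

/-- The pull-back identity `(Jac γ z)ᵀ F(γ z) = F(z)`, `F = ψ^* α`, for `γ ∈ Γ`. [cite: Borel1997, §5.14] -/
theorem transpose_jac_mulVec_formPullback₁ (γ : D.Γ) (z : Ball) :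
    (Jac (D.ballRep 𝔣 γ) z)ᵀ *ᵥ D.formPullback₁ A 𝔣 (α : MForm 𝓘(ℝ, A.model) A.carrier ℂ 1)
        (D.ballRep 𝔣 γ • z) =
      D.formPullback₁ A 𝔣 (α : MForm 𝓘(ℝ, A.model) A.carrier ℂ 1) z :=
  BallForms.transpose_jac_mulVec_eq_of_mem_factorForms (D.formPullback₁_coe_mem_factorForms A 𝔣 α)
    (Subgroup.mem_map_of_mem _ (Subgroup.mem_top γ)) z

/-- **Transformation law** `P(γ z) = P(z) + c(γ)` for the holomorphic primitive `P` of `ψ^* α` and its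
period `c(γ) = BallForms.period (ψ^* α) (ρ_𝔣 γ)`, `γ ∈ Γ`. [cite: GriffithsHarris1978, Ch. 2 §6]
[cite: Borel1997, §5.14] -/
theorem primitive_formPullback₁_smul_eq_add_period (γ : D.Γ) (z : Ball) :
    BallForms.primitive (D.formPullback₁ A 𝔣 (α : MForm 𝓘(ℝ, A.model) A.carrier ℂ 1))
        (D.ballRep 𝔣 γ • z) =
      BallForms.primitive (D.formPullback₁ A 𝔣 (α : MForm 𝓘(ℝ, A.model) A.carrier ℂ 1)) z +
        BallForms.period (D.formPullback₁ A 𝔣 (α : MForm 𝓘(ℝ, A.model) A.carrier ℂ 1))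
          (D.ballRep 𝔣 γ) :=
  BallForms.primitive_smul_eq_add_period (D.formPullback₁_coe_mem_holomorphic A 𝔣 α)
    (isClosedForm_formPullback₁_of_mem (D := D) (A := A) (𝔣 := 𝔣) α)
    (D.transpose_jac_mulVec_formPullback₁ A 𝔣 α γ) z

/-- **Additivity of the periods on `Γ`**: `c(γδ) = c(γ) + c(δ)`. [cite: GriffithsHarris1978, Ch. 2 §6] -/
theorem period_formPullback₁_mul (γ δ : D.Γ) :
    BallForms.period (D.formPullback₁ A 𝔣 (α : MForm 𝓘(ℝ, A.model) A.carrier ℂ 1))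
        (D.ballRep 𝔣 (γ * δ)) =
      BallForms.period (D.formPullback₁ A 𝔣 (α : MForm 𝓘(ℝ, A.model) A.carrier ℂ 1)) (D.ballRep 𝔣 γ) +
        BallForms.period (D.formPullback₁ A 𝔣 (α : MForm 𝓘(ℝ, A.model) A.carrier ℂ 1))
          (D.ballRep 𝔣 δ) := by
  rw [map_mul]
  exact BallForms.period_mul (D.formPullback₁_coe_mem_holomorphic A 𝔣 α)
    (isClosedForm_formPullback₁_of_mem (D := D) (A := A) (𝔣 := 𝔣) α)
    (D.transpose_jac_mulVec_formPullback₁ A 𝔣 α γ) _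

/-- The periods are additive in the form. [cite: GriffithsHarris1978, Ch. 2 §6] -/
theorem period_formPullback₁_add (α β : holFormsInCharts A.model A.carrier 1) (g : U21) :
    BallForms.period (D.formPullback₁ A 𝔣 ((α + β : holFormsInCharts A.model A.carrier 1) :
        MForm 𝓘(ℝ, A.model) A.carrier ℂ 1)) g =
      BallForms.period (D.formPullback₁ A 𝔣 (α : MForm 𝓘(ℝ, A.model) A.carrier ℂ 1)) g +
        BallForms.period (D.formPullback₁ A 𝔣 (β : MForm 𝓘(ℝ, A.model) A.carrier ℂ 1)) g := by
  rw [Submodule.coe_add, map_add]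
  exact BallForms.period_add (D.formPullback₁_coe_mem_holomorphic A 𝔣 α)
    (D.formPullback₁_coe_mem_holomorphic A 𝔣 β) g

/-- The periods are homogeneous in the form. [cite: GriffithsHarris1978, Ch. 2 §6] -/
theorem period_formPullback₁_smul (a : ℂ) (g : U21) :
    BallForms.period (D.formPullback₁ A 𝔣 ((a • α : holFormsInCharts A.model A.carrier 1) :
        MForm 𝓘(ℝ, A.model) A.carrier ℂ 1)) g =
      a * BallForms.period (D.formPullback₁ A 𝔣 (α : MForm 𝓘(ℝ, A.model) A.carrier ℂ 1)) g := by
  rw [Submodule.coe_smul, map_smul]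
  exact BallForms.period_smul a _ g

end Forms

/-! ### The period vector, the period homomorphism and the period group -/

section Lattice

variable {ι : Type} (b : Basis ι ℂ (holFormsInCharts A.model A.carrier 1))

/-- **The period vector of `γ ∈ Γ`** in the basis `b` of `Ω¹(X^an)`: `(c_{b i}(γ))ᵢ ∈ ℂ^ι`, with
`c_{b i}(γ) = BallForms.period (ψ^* bᵢ) (ρ_𝔣 γ)` the period of the `i`-th basis form along `γ`
(Griffiths–Harris: `(∫_γ ω₁, …, ∫_γ ω_q)`). [cite: GriffithsHarris1978, Ch. 2 §6] -/
def periodVec (γ : D.Γ) : ι → ℂ :=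
  fun i ↦ BallForms.period (D.formPullback₁ A 𝔣 ((b i : holFormsInCharts A.model A.carrier 1) :
    MForm 𝓘(ℝ, A.model) A.carrier ℂ 1)) (D.ballRep 𝔣 γ)

/-- Coordinates of the period vector. [cite: GriffithsHarris1978, Ch. 2 §6] -/
theorem periodVec_apply (γ : D.Γ) (i : ι) :
    D.periodVec A 𝔣 b γ i = BallForms.period (D.formPullback₁ A 𝔣
      ((b i : holFormsInCharts A.model A.carrier 1) : MForm 𝓘(ℝ, A.model) A.carrier ℂ 1)) (D.ballRep 𝔣 γ) :=
  rfl

/-- **The period vector is additive on `Γ`**: `λ(γδ) = λ(γ) + λ(δ)`. [cite: GriffithsHarris1978, Ch. 2 §6] -/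
theorem periodVec_mul (γ δ : D.Γ) :
    D.periodVec A 𝔣 b (γ * δ) = D.periodVec A 𝔣 b γ + D.periodVec A 𝔣 b δ := by
  funext i
  exact D.period_formPullback₁_mul A 𝔣 (b i) γ δ

/-- `λ(1) = 0`. [cite: GriffithsHarris1978, Ch. 2 §6] -/
@[simp] theorem periodVec_one : D.periodVec A 𝔣 b 1 = 0 := by
  funext i
  simp [periodVec_apply]

/-- **The period homomorphism** `Γ → (ℂ^ι, +)`, `γ ↦ λ(γ)` (on `Additive Γ`).
[cite: GriffithsHarris1978, Ch. 2 §6] -/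
def periodHom : Additive D.Γ →+ (ι → ℂ) where
  toFun γ := D.periodVec A 𝔣 b (Additive.toMul γ)
  map_zero' := D.periodVec_one A 𝔣 b
  map_add' γ δ := D.periodVec_mul A 𝔣 b (Additive.toMul γ) (Additive.toMul δ)

/-- Unfolding `periodHom`. [cite: GriffithsHarris1978, Ch. 2 §6] -/
@[simp] theorem periodHom_apply (γ : Additive D.Γ) :
    D.periodHom A 𝔣 b γ = D.periodVec A 𝔣 b (Additive.toMul γ) := rfl

/-- **The period group `Λ ⊆ ℂ^ι`** of `X` in the basis `b`: the image of the period homomorphism (an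
additive subgroup of `ℂ^ι`; its `ℤ`-module structure is the canonical one of an abelian group).
[cite: GriffithsHarris1978, Ch. 2 §6] -/
def periodLattice : AddSubgroup (ι → ℂ) :=
  (D.periodHom A 𝔣 b).range

/-- Membership in the period group: `v ∈ Λ ↔ v = λ(γ)` for some `γ ∈ Γ`. [cite: GriffithsHarris1978, Ch. 2 §6] -/
theorem mem_periodLattice_iff {v : ι → ℂ} :
    v ∈ D.periodLattice A 𝔣 b ↔ ∃ γ : D.Γ, D.periodVec A 𝔣 b γ = v := by
  rw [periodLattice, AddMonoidHom.mem_range]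
  constructor
  · rintro ⟨γ, rfl⟩
    exact ⟨Additive.toMul γ, rfl⟩
  · rintro ⟨γ, rfl⟩
    exact ⟨Additive.ofMul γ, rfl⟩

/-- Period vectors lie in the period group. [cite: GriffithsHarris1978, Ch. 2 §6] -/
theorem periodVec_mem_periodLattice (γ : D.Γ) : D.periodVec A 𝔣 b γ ∈ D.periodLattice A 𝔣 b :=
  (D.mem_periodLattice_iff A 𝔣 b).2 ⟨γ, rfl⟩

/-- The period group as a set is the range of the period vector. [cite: GriffithsHarris1978, Ch. 2 §6] -/
theorem coe_periodLattice :
    (D.periodLattice A 𝔣 b : Set (ι → ℂ)) = Set.range (D.periodVec A 𝔣 b) := by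
  ext v
  exact D.mem_periodLattice_iff A 𝔣 b

/-! ### Finite generation, freeness and the rank bound -/

/-- **The period group is finitely generated** (`Γ` is finitely generated, `fg_Γ`).
[cite: GriffithsHarris1978, Ch. 2 §6] [cite: HatcherAT2002, proof of Thm. 1.20] -/
theorem fg_periodLattice : AddGroup.FG (D.periodLattice A 𝔣 b) := by
  haveI := D.fg_Γ
  exact AddGroup.fg_range _

/-- The period group is a finite `ℤ`-module. [cite: GriffithsHarris1978, Ch. 2 §6] -/
theorem finite_periodLattice : Module.Finite ℤ (D.periodLattice A 𝔣 b) :=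
  Module.Finite.iff_addGroup_fg.2 (D.fg_periodLattice A 𝔣 b)

/-- The period group is torsion free (a subgroup of the vector space `ℂ^ι`). [cite: GriffithsHarris1978, Ch. 2 §6] -/
theorem isTorsionFree_periodLattice : IsTorsionFree ℤ (D.periodLattice A 𝔣 b) := by
  refine Module.IsTorsionFree.of_smul_eq_zero fun n m h ↦ ?_
  have h' : n • (m : ι → ℂ) = 0 := by
    have := congrArg (Subtype.val : D.periodLattice A 𝔣 b → ι → ℂ) h
    simpa using this
  rcases smul_eq_zero.1 h' with hn | hm
  · exact Or.inl hn
  · exact Or.inr (Subtype.ext hm)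

/-- **The period group is a free `ℤ`-module** (finitely generated and torsion free).
[cite: GriffithsHarris1978, Ch. 2 §6] -/
theorem free_periodLattice : Module.Free ℤ (D.periodLattice A 𝔣 b) := by
  haveI := D.finite_periodLattice A 𝔣 b
  haveI := D.isTorsionFree_periodLattice A 𝔣 b
  infer_instance

include D 𝔣 in
/-- `X(ℂ)` is path connected (the continuous image of the path-connected ball under the uniformisation).
[cite: BergeronMillsonMoeglin2016Balls, Introduction §1.1] -/
theorem pathConnectedSpace_complexPoints_of_ballUnifMap : PathConnectedSpace (Motives.ComplexPoints X) := by
  rw [pathConnectedSpace_iff_univ, ← (D.ballUnifMap_surjective 𝔣).range_eq, ← Set.image_univ]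
  exact isPathConnected_univ.image (D.continuous_ballUnifMap 𝔣)

/-- **The rank of the period group is at most `b₁(X)`**: `Λ` is an additive image of
`π₁(X(ℂ), ψ(0)) ≅ Γ` and a free finitely generated abelian quotient of `π₁` has rank at most
`dim_ℚ H¹(X(ℂ); ℚ)`. [cite: GriffithsHarris1978, Ch. 2 §6] [cite: HatcherAT2002, Thm. 2A.1 and §3.1 p. 198] -/
theorem finrank_periodLattice_le :
    Module.finrank ℤ (D.periodLattice A 𝔣 b) ≤ Module.finrank ℚ (bettiCohomology X 1) := by
  haveI := D.finite_periodLattice A 𝔣 b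
  haveI := D.free_periodLattice A 𝔣 b
  haveI : Module.Finite ℚ (bettiCohomology X 1) :=
    finite_singularCohomology_rat_complexPoints D.isSmoothProjective 1
  haveI := D.pathConnectedSpace_complexPoints_of_ballUnifMap 𝔣
  -- `π₁(X(ℂ), ψ 0) ≃* Γᵐᵒᵖ ≃* Γ`
  obtain ⟨e⟩ := D.nonempty_fundamentalGroup_complexPoints_mulEquiv 𝔣 x₀
  let e' : FundamentalGroup (Motives.ComplexPoints X) (D.ballUnifMap 𝔣 x₀) ≃* D.Γ :=
    e.trans (MulEquiv.inv' D.Γ).symm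
  -- the surjection `π₁ → Λ`
  let θ : Additive (FundamentalGroup (Motives.ComplexPoints X) (D.ballUnifMap 𝔣 x₀)) →+ (ι → ℂ) :=
    (D.periodHom A 𝔣 b).comp (MonoidHom.toAdditive e'.toMonoidHom)
  have hθ : ∀ g, θ g ∈ D.periodLattice A 𝔣 b := fun g ↦
    ⟨MonoidHom.toAdditive e'.toMonoidHom g, rfl⟩
  let lam : Additive (FundamentalGroup (Motives.ComplexPoints X) (D.ballUnifMap 𝔣 x₀)) →+
      D.periodLattice A 𝔣 b := θ.codRestrict (D.periodLattice A 𝔣 b) hθ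
  have hsurj : Function.Surjective lam := by
    rintro ⟨v, hv⟩
    obtain ⟨g, rfl⟩ := (AddMonoidHom.mem_range).1 hv
    refine ⟨Additive.ofMul (e'.symm (Additive.toMul g)), Subtype.ext ?_⟩
    change D.periodHom A 𝔣 b (Additive.ofMul (e' (e'.symm (Additive.toMul g)))) = D.periodHom A 𝔣 b g
    rw [MulEquiv.apply_symm_apply]
    rfl
  exact finrank_le_finrank_singularCohomology_one_of_surjective (D.ballUnifMap 𝔣 x₀) lam hsurj

end Lattice

end UnitaryBallUniformisationDatum

end Literature.AlgebraicGeometry.ShimuraVarieties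

end
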